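import Literature.NumberTheory.LFunctions.VinogradovKorobovZeroDetector
import Mathlib.Analysis.MellinInversion
import HarnessLib

/-!
# Laplace inversion for Ford's smoothing functions and formula (4.6) of Ford 2002, Lemma 4.5

Topic `Literature/NumberTheory/LFunctions`, family RH (explicit zero-free regions). Everything in
this file is PROVED; no named fact, no definition.

K. Ford, *Zero-free regions for the Riemann zeta function* (2002), Lemma 4.5, starts from
`I(s) = (1/2πi) ∫_{(α)} (−ζ'/ζ)(w) F₀(s − w) dw`, `F₀(z) = F(z) − f(0)/z = ∫_0^∞ e^{−zu}(f(u) − f(0)) du`,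
`1 < α < Re s`, integrates the Dirichlet series of `−ζ'/ζ` term by term and evaluates each term by a
Perron-type integral, obtaining **(4.6)** `I(s) = K(s) + f(0) ζ'(s)/ζ(s)`,
`K(s) = Σ Λ(n) n^{−s} f(log n)` (the tree's `fordK`). This file proves (4.6):

* `FordL45.integral_LSeries_vonMangoldt_mul_laplace` — for an admissible smoothing
  (`IsFordSmoothing f η D`, `η > 0`) and `1 < α < Re s`:
  `(1/2π) ∫ L(Λ, α + iy) · ℒ(f − f(0))(s − α − iy) dy = fordK f s + f(0) ζ'(s)/ζ(s)`.

The termwise evaluation is genuine **Laplace inversion**, obtained from Mathlib's Mellin inversion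
theorem (`mellinInv_mellin_eq`) through `x = e^{−u}`:

* `FordL45.mellin_indicator_comp_neg_log` — `mellin φ_g = ℒg` for `φ_g(x) = g(−log x)𝟙_{x<1}`;
* `FordL45.laplace_inversion` — `(1/2π) ∫ x^{c+iy} ℒg(c + iy) dy = g(log x)` for `x > 1`, `c > 0`,
  `g` continuous and bounded on `(0, ∞)`, `ℒg` integrable on `Re z = c`;
* `FordL45.fordLaplace_sub_const` (`ℒ(f − f(0)) = F − f(0)/z` on `Re z > 0`),
  `FordL45.continuousAt_fordLaplace` (continuity of `ℒg` on `Re z > 0`, dominated convergence),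
  `FordL45.verticalIntegrable_fordLaplace_sub` (integrability of `F₀` on every line `Re z = c > 0`,
  from continuity and Ford's (4.5) `|F₀(z)| ≤ D/|z|²`);
* the interchange of sum and integral is `integral_tsum_of_summable_integral_norm` with
  `Σ Λ(n) n^{−α} · ∫ |F₀(c + iy)| dy < ∞`.

## References

* K. Ford, *Zero-free regions for the Riemann zeta function*, Number Theory for the Millennium II
  (Urbana 2000), A K Peters 2002, 25–56 (arXiv:1910.08205), Lemma 4.5, (4.6). [Ford2002Millennium]
-/

noncomputable section

open Complex Real Set MeasureTheory Filter Topology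

namespace Literature.NumberTheory.LFunctions

namespace FordL45

/-! ### The Laplace transform of a bounded function as a Mellin transform -/

/-- **`ℒg` as a Mellin transform**: with `φ_g(x) = g(−log x)` for `0 < x < 1` and `0` for `x ≥ 1`
(written inline; no definition is introduced), `mellin φ_g s = ∫_0^∞ e^{−su} g(u) du = fordLaplace g s`
for every `s` (substitution `x = e^{−u}`; both sides junk together). [folklore] -/
theorem mellin_indicator_comp_neg_log (g : ℝ → ℝ) (s : ℂ) :
    mellin (fun x : ℝ ↦ if x < 1 then ((g (-Real.log x) : ℝ) : ℂ) else 0) s = fordLaplace g s := by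
  -- substitute `x = e^{-u}`, `u ∈ ℝ`
  have hderiv : ∀ u ∈ (univ : Set ℝ), HasDerivWithinAt (fun u : ℝ ↦ Real.exp (-u)) (-Real.exp (-u)) univ u :=
    fun u _ ↦ (((Real.hasDerivAt_exp (-u)).comp u (hasDerivAt_neg u)).congr_deriv (by ring)).hasDerivWithinAt
  have hinj : InjOn (fun u : ℝ ↦ Real.exp (-u)) univ :=
    fun a _ b _ h ↦ by simpa using Real.exp_injective h
  have himage : (fun u : ℝ ↦ Real.exp (-u)) '' univ = Ioi 0 := by
    ext x
    simp only [mem_image, mem_univ, true_and, mem_Ioi]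
    constructor
    · rintro ⟨u, rfl⟩; exact Real.exp_pos _
    · intro hx; exact ⟨-Real.log x, by rw [neg_neg, Real.exp_log hx]⟩
  rw [mellin, ← himage, integral_image_eq_integral_abs_deriv_smul MeasurableSet.univ hderiv hinj,
    setIntegral_univ, fordLaplace]
  -- the integrand: `e^{-u} (e^{-u})^{s-1} φ(e^{-u}) = e^{-su} g(u)` for `u > 0`, `0` for `u ≤ 0`
  rw [← integral_indicator measurableSet_Ioi]
  refine integral_congr_ae (ae_of_all _ fun u ↦ ?_)
  have key : ((Real.exp (-u) : ℝ) : ℂ) * ((Real.exp (-u) : ℝ) : ℂ) ^ (s - 1) = Complex.exp (-(s * u)) := by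
    rw [Complex.ofReal_exp, show (((-u : ℝ)) : ℂ) = -(u : ℂ) by push_cast; ring]
    rw [show Complex.exp (-(u : ℂ)) * Complex.exp (-(u : ℂ)) ^ (s - 1) =
      Complex.exp (-(u : ℂ)) ^ (1 : ℂ) * Complex.exp (-(u : ℂ)) ^ (s - 1) by rw [cpow_one]]
    rw [← cpow_add _ _ (Complex.exp_ne_zero _), cpow_def_of_ne_zero (Complex.exp_ne_zero _),
      Complex.log_exp (by simp [Real.pi_pos]) (by simpa using Real.pi_pos.le)]
    ring_nf
  simp only [abs_neg, abs_of_pos (Real.exp_pos _), Real.log_exp, neg_neg, Complex.real_smul, smul_eq_mul]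
  by_cases hu : 0 < u
  · have hlt : Real.exp (-u) < 1 := by
      have := Real.exp_lt_exp.2 (show -u < 0 by linarith); rwa [Real.exp_zero] at this
    rw [if_pos hlt, indicator_of_mem (mem_Ioi.2 hu), ← mul_assoc, key]
  · have hge : ¬ Real.exp (-u) < 1 := by rw [not_lt, Real.one_le_exp_iff]; linarith
    rw [if_neg hge, indicator_of_notMem (by simpa using hu)]
    simp

/-- `φ_g` is measurable when `g` is continuous. [folklore] -/
theorem measurable_indicator_comp_neg_log {g : ℝ → ℝ} (hg : Continuous g) :
    Measurable (fun x : ℝ ↦ if x < 1 then ((g (-Real.log x) : ℝ) : ℂ) else 0) := by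
  refine Measurable.ite measurableSet_Iio ?_ measurable_const
  exact Complex.measurable_ofReal.comp (hg.measurable.comp (Real.measurable_log.neg))

/-- Mellin convergence of `φ_g` at any `c > 0` when `g` is continuous and bounded
(`|t^{c−1} φ_g(t)| ≤ M t^{c−1}` on `(0, 1)`, `0` beyond). [folklore] -/
theorem mellinConvergent_indicator_comp_neg_log {g : ℝ → ℝ} (hg : Continuous g) {M : ℝ}
    (hM : ∀ u, 0 < u → |g u| ≤ M) {c : ℝ} (hc : 0 < c) :
    MellinConvergent (fun x : ℝ ↦ if x < 1 then ((g (-Real.log x) : ℝ) : ℂ) else 0) c := by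
  rw [MellinConvergent]
  have hM0 : 0 ≤ M := (abs_nonneg _).trans (hM 1 one_pos)
  -- the majorant `M t^{c-1}` on `(0,1]`, `0` on `(1, ∞)`
  have hIoc : IntegrableOn (fun t : ℝ ↦ M * t ^ (c - 1)) (Ioc (0 : ℝ) 1) := by
    have h := (intervalIntegral.intervalIntegrable_rpow' (a := 0) (b := 1) (by linarith : -1 < c - 1)).const_mul M
    rwa [intervalIntegrable_iff_integrableOn_Ioc_of_le zero_le_one] at h
  have hmaj : IntegrableOn (fun t : ℝ ↦ (Ioc (0 : ℝ) 1).indicator (fun t ↦ M * t ^ (c - 1)) t) (Ioi 0) :=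
    (hIoc.integrable_indicator measurableSet_Ioc).integrableOn
  refine Integrable.mono' hmaj ?_ ?_
  · have h1 : Measurable fun t : ℝ ↦ (t : ℂ) ^ ((c : ℂ) - 1) := Complex.measurable_ofReal.pow_const _
    exact (h1.smul (measurable_indicator_comp_neg_log hg)).aestronglyMeasurable
  · rw [ae_restrict_iff' measurableSet_Ioi]
    refine ae_of_all _ fun t (ht : 0 < t) ↦ ?_
    rw [norm_smul, Complex.norm_cpow_eq_rpow_re_of_pos ht]
    simp only [sub_re, ofReal_re, one_re]
    by_cases h1 : t < 1
    · have hmem : t ∈ Ioc (0 : ℝ) 1 := ⟨ht, h1.le⟩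
      rw [if_pos h1, indicator_of_mem hmem, Complex.norm_real, Real.norm_eq_abs, mul_comm]
      have hlog : 0 < -Real.log t := by rw [neg_pos]; exact Real.log_neg ht h1
      exact mul_le_mul_of_nonneg_right (hM _ hlog) (Real.rpow_nonneg ht.le _)
    · rw [if_neg h1, norm_zero, mul_zero]
      exact indicator_nonneg (fun u hu ↦ mul_nonneg hM0 (Real.rpow_nonneg hu.1.le _)) _

/-- **Laplace inversion** (the "Perron" step in Ford's proof of Lemma 4.5, via Mellin inversion):
let `g` be continuous and bounded, `c > 0`, and suppose the Laplace transform
`G(z) = ∫_0^∞ e^{−zu} g(u) du` is integrable along the line `Re z = c`. Then for `x > 1`,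
`(1/2π) ∫_{−∞}^{∞} x^{c+iy} G(c + iy) dy = g(log x)`, i.e.
`(1/2πi) ∫_{(c)} x^{w} G(w) dw = g(log x)`. [folklore] -/
theorem laplace_inversion {g : ℝ → ℝ} (hg : Continuous g) {M : ℝ} (hM : ∀ u, 0 < u → |g u| ≤ M) {c : ℝ}
    (hc : 0 < c) (hV : Complex.VerticalIntegrable (fordLaplace g) c) {x : ℝ} (hx : 1 < x) :
    ((1 / (2 * π) : ℝ) : ℂ) * ∫ y : ℝ, (x : ℂ) ^ ((c : ℂ) + y * I) * fordLaplace g (c + y * I) =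
      g (Real.log x) := by
  set φ : ℝ → ℂ := fun t ↦ if t < 1 then ((g (-Real.log t) : ℝ) : ℂ) else 0 with hφ
  have hmel : mellin φ = fordLaplace g := funext fun s ↦ mellin_indicator_comp_neg_log g s
  have hx0 : 0 < x := by linarith
  have hxi : x⁻¹ < 1 := inv_lt_one_of_one_lt₀ hx
  have hcont : ContinuousAt φ x⁻¹ := by
    have hev : φ =ᶠ[𝓝 x⁻¹] fun t ↦ ((g (-Real.log t) : ℝ) : ℂ) := by
      filter_upwards [isOpen_Iio.mem_nhds hxi] with t ht
      simp [hφ, (mem_Iio.1 ht)]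
    refine ContinuousAt.congr ?_ hev.symm
    exact Complex.continuous_ofReal.continuousAt.comp
      (hg.continuousAt.comp ((Real.continuousAt_log (inv_pos.2 hx0).ne').neg))
  have h := mellinInv_mellin_eq c φ (inv_pos.2 hx0) (mellinConvergent_indicator_comp_neg_log hg hM hc)
    (by rw [hmel]; exact hV) hcont
  rw [hmel, mellinInv] at h
  have hφx : φ x⁻¹ = g (Real.log x) := by
    simp [hφ, hxi, Real.log_inv]
  rw [hφx] at h
  rw [← h, Complex.real_smul]
  congr 1
  refine integral_congr_ae (ae_of_all _ fun y ↦ ?_)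
  simp only [smul_eq_mul]
  congr 1
  have harg : ((x : ℂ)).arg ≠ π := by
    rw [Complex.arg_ofReal_of_nonneg hx0.le]; exact Real.pi_pos.ne
  rw [Complex.ofReal_inv, Complex.inv_cpow _ _ harg, Complex.cpow_neg, inv_inv]

/-! ### The Laplace transform of a bounded continuous function on `Re z > 0` -/

/-- The integrand `e^{−zu} g(u)` is integrable on `(0, ∞)` for `Re z > 0`, `g` continuous and
bounded. [folklore] -/
theorem integrableOn_laplace_integrand {g : ℝ → ℝ} (hg : Continuous g) {M : ℝ} (hM : ∀ u, 0 < u → |g u| ≤ M)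
    {z : ℂ} (hz : 0 < z.re) :
    IntegrableOn (fun u : ℝ ↦ Complex.exp (-(z * u)) * (g u : ℂ)) (Ioi 0) := by
  have h1 : IntegrableOn (fun u : ℝ ↦ Complex.exp (-z * u)) (Ioi 0) :=
    integrableOn_exp_mul_complex_Ioi (by simpa using hz) 0
  refine (h1.norm.const_mul M).mono' ?_ ?_
  · exact ((Complex.continuous_exp.comp (by fun_prop)).mul
      (Complex.continuous_ofReal.comp hg)).aestronglyMeasurable
  · rw [ae_restrict_iff' measurableSet_Ioi]
    refine ae_of_all _ fun u (hu : 0 < u) ↦ ?_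
    rw [norm_mul, Complex.norm_real, Real.norm_eq_abs, neg_mul, mul_comm]
    exact mul_le_mul_of_nonneg_right (hM u hu) (norm_nonneg _)

/-- **`F₀ = ℒ(f − f(0))`**: for `Re z > 0`, `∫_0^∞ e^{−zu}(f(u) − f(0)) du = F(z) − f(0)/z`
(`∫_0^∞ e^{−zu} du = 1/z`). [cite: Ford2002Millennium, Lemma 4.5 (proof)] -/
theorem fordLaplace_sub_const {f : ℝ → ℝ} (hf : Continuous f) {M : ℝ} (hM : ∀ u, 0 < u → |f u| ≤ M)
    {z : ℂ} (hz : 0 < z.re) :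
    fordLaplace (fun u ↦ f u - f 0) z = fordLaplace f z - (f 0 : ℂ) / z := by
  have hz0 : z ≠ 0 := by intro h; rw [h] at hz; simp at hz
  have hI := integrableOn_laplace_integrand hf hM hz
  have hE : IntegrableOn (fun u : ℝ ↦ Complex.exp (-z * u)) (Ioi 0) :=
    integrableOn_exp_mul_complex_Ioi (by simpa using hz) 0
  have hint := integral_exp_mul_complex_Ioi (a := -z) (by simpa using hz) 0
  simp only [fordLaplace]
  have e : (fun u : ℝ ↦ Complex.exp (-(z * u)) * (((f u - f 0 : ℝ)) : ℂ)) =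
      fun u : ℝ ↦ Complex.exp (-(z * u)) * (f u : ℂ) - (f 0 : ℂ) * Complex.exp (-z * u) := by
    funext u; push_cast; ring_nf
  rw [e, integral_sub hI (hE.const_mul _), MeasureTheory.integral_const_mul, hint]
  simp only [ofReal_zero, mul_zero, Complex.exp_zero]
  field_simp

/-- **Continuity of the Laplace transform in `z` on `Re z > 0`** (`g` continuous and bounded;
dominated convergence with `M e^{−(Re z₀/2)u}`). [folklore] -/
theorem continuousAt_fordLaplace {g : ℝ → ℝ} (hg : Continuous g) {M : ℝ} (hM : ∀ u, 0 < u → |g u| ≤ M)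
    {z₀ : ℂ} (hz₀ : 0 < z₀.re) : ContinuousAt (fordLaplace g) z₀ := by
  have hM0 : 0 ≤ M := (abs_nonneg _).trans (hM 1 one_pos)
  set c : ℝ := z₀.re / 2 with hc
  have hc0 : 0 < c := by positivity
  have hnhds : ∀ᶠ z in 𝓝 z₀, c < z.re :=
    (Complex.continuous_re.tendsto z₀).eventually (eventually_gt_nhds (by rw [hc]; linarith))
  have hdef : fordLaplace g = fun z ↦ ∫ u in Ioi (0 : ℝ), Complex.exp (-(z * u)) * (g u : ℂ) := rfl
  rw [hdef]
  refine continuousAt_of_dominated (μ := volume.restrict (Ioi 0))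
    (bound := fun u ↦ M * ‖Complex.exp (-(c : ℂ) * u)‖) ?_ ?_ ?_ ?_
  · refine Eventually.of_forall fun z ↦ ?_
    exact ((Complex.continuous_exp.comp (by fun_prop)).mul
      (Complex.continuous_ofReal.comp hg)).aestronglyMeasurable
  · filter_upwards [hnhds] with z hz
    rw [ae_restrict_iff' measurableSet_Ioi]
    refine ae_of_all _ fun u (hu : 0 < u) ↦ ?_
    rw [norm_mul, Complex.norm_real, Real.norm_eq_abs, mul_comm]
    refine mul_le_mul (hM u hu) ?_ (norm_nonneg _) hM0
    rw [Complex.norm_exp, Complex.norm_exp]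
    refine Real.exp_le_exp.2 ?_
    simp only [neg_re, mul_re, ofReal_re, ofReal_im, mul_zero, sub_zero, neg_mul]
    nlinarith
  · exact ((integrableOn_exp_mul_complex_Ioi (a := -(c : ℂ)) (by simpa using hc0) 0).norm.const_mul M)
  · refine ae_of_all _ fun u ↦ ?_
    exact ((Complex.continuous_exp.comp (by fun_prop : Continuous fun z : ℂ ↦ -(z * u))).mul
      continuous_const).continuousAt

/-- **Vertical integrability of `F₀` for a Ford smoothing.** If `f` is an admissible smoothing
(`IsFordSmoothing f η D`, `η > 0`) then for every `c > 0` the function `y ↦ F₀(c + iy)`,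
`F₀ = ℒ(f − f(0)) = F − f(0)/z`, is integrable on `ℝ`: it is continuous (`continuousAt_fordLaplace`)
and `O(D/y²)` for `|y| ≥ η` by Ford's (4.5). [cite: Ford2002Millennium, (4.5) and Lemma 4.5 (proof)] -/
theorem verticalIntegrable_fordLaplace_sub {f : ℝ → ℝ} {η D : ℝ} (hf : IsFordSmoothing f η D)
    (hη : 0 < η) {c : ℝ} (hc : 0 < c) :
    Complex.VerticalIntegrable (fordLaplace (fun u ↦ f u - f 0)) c := by
  -- `f` is continuous and bounded
  have hfc : Continuous f := hf.contDiff.continuous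
  obtain ⟨x₀, hx₀⟩ := hf.eventually_zero
  obtain ⟨M, hM⟩ : ∃ M, ∀ u, 0 ≤ u → |f u| ≤ M := by
    obtain ⟨B, hB⟩ := (isCompact_Icc (a := (0 : ℝ)) (b := |x₀| + 1)).exists_bound_of_continuousOn
      hfc.continuousOn
    refine ⟨max B 0, fun u hu ↦ ?_⟩
    by_cases hux : u ≤ |x₀| + 1
    · exact ((Real.norm_eq_abs _).symm.le.trans (hB u ⟨hu, hux⟩)).trans (le_max_left _ _)
    · have : f u = 0 := hx₀ u (by linarith [le_abs_self x₀])
      rw [this, abs_zero]; exact le_max_right _ _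
  set g : ℝ → ℝ := fun u ↦ f u - f 0 with hg
  have hgc : Continuous g := hfc.sub continuous_const
  have hgM : ∀ u, 0 < u → |g u| ≤ 2 * M := by
    intro u hu
    calc |g u| = |f u - f 0| := rfl
      _ ≤ |f u| + |f 0| := abs_sub _ _
      _ ≤ M + M := add_le_add (hM u hu.le) (hM 0 le_rfl)
      _ = 2 * M := by ring
  have hfM : ∀ u, 0 < u → |f u| ≤ M := fun u hu ↦ hM u hu.le
  set F : ℂ → ℂ := fordLaplace g with hF
  -- continuity along the line
  have hcont : Continuous fun y : ℝ ↦ F ((c : ℂ) + y * I) := by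
    refine continuous_iff_continuousAt.2 fun y ↦ ?_
    have h1 : ContinuousAt F ((c : ℂ) + y * I) :=
      continuousAt_fordLaplace hgc hgM (by simp; exact hc)
    exact ContinuousAt.comp (f := fun y : ℝ ↦ (c : ℂ) + y * I) h1 (Continuous.continuousAt (by fun_prop))
  -- Ford's (4.5) on the line, `|y| ≥ η`
  have hD : ∀ y : ℝ, η ≤ |y| → ‖F ((c : ℂ) + y * I)‖ ≤ D / y ^ 2 := by
    intro y hy
    have hz : (0 : ℝ) < ((c : ℂ) + y * I).re := by simp; exact hc
    have hnorm : |y| ≤ ‖(c : ℂ) + y * I‖ := by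
      have := Complex.abs_im_le_norm ((c : ℂ) + y * I); simpa using this
    have hy0 : 0 < |y| := hη.trans_le hy
    have h := hf.laplace_bound ((c : ℂ) + y * I) hz.le (hy.trans hnorm)
    rw [hF, fordLaplace_sub_const hfc hfM hz]
    refine h.trans ?_
    have hpos : 0 < ‖(c : ℂ) + y * I‖ ^ 2 := by have := hy0.trans_le hnorm; positivity
    have hD0 : 0 ≤ D := by
      by_contra hneg
      have : D / ‖(c : ℂ) + y * I‖ ^ 2 < 0 := div_neg_of_neg_of_pos (not_le.1 hneg) hpos
      linarith [(norm_nonneg _).trans h]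
    rw [← sq_abs y]
    exact div_le_div_of_nonneg_left hD0 (by positivity) (pow_le_pow_left₀ (abs_nonneg y) hnorm 2)
  -- a bound on the compact part `|y| ≤ R₀`
  set R₀ : ℝ := max η 1 with hR₀
  obtain ⟨S, hS⟩ := (isCompact_Icc (a := -R₀) (b := R₀)).exists_bound_of_continuousOn hcont.continuousOn
  have hS0 : 0 ≤ S := (norm_nonneg _).trans (hS 0 ⟨by rw [hR₀]; have := le_max_right η 1; linarith,
    by rw [hR₀]; have := le_max_right η 1; linarith⟩)
  have hD0' : 0 ≤ D := by
    have h := hD R₀ (by rw [abs_of_nonneg (by positivity)]; exact le_max_left _ _)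
    have hpos : 0 < R₀ ^ 2 := by positivity
    by_contra hneg
    have : D / R₀ ^ 2 < 0 := div_neg_of_neg_of_pos (not_le.1 hneg) hpos
    linarith [(norm_nonneg _).trans h]
  set K : ℝ := max (S * (1 + R₀ ^ 2)) (2 * D) with hK
  refine Integrable.mono' ((integrable_inv_one_add_sq.const_mul K)) hcont.aestronglyMeasurable
    (ae_of_all _ fun y ↦ ?_)
  have h1y : 0 < 1 + y ^ 2 := by positivity
  rcases le_or_gt |y| R₀ with hy | hy
  · have hb := hS y ⟨by linarith [neg_abs_le y], by linarith [le_abs_self y]⟩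
    have hy2 : y ^ 2 ≤ R₀ ^ 2 := by nlinarith [abs_nonneg y, sq_abs y]
    calc ‖F ((c : ℂ) + y * I)‖ ≤ S := hb
      _ ≤ S * (1 + R₀ ^ 2) * (1 + y ^ 2)⁻¹ := by
          rw [mul_assoc, ← div_eq_mul_inv]
          have h1 : 1 ≤ (1 + R₀ ^ 2) / (1 + y ^ 2) := by
            rw [le_div_iff₀ h1y]; linarith
          nlinarith
      _ ≤ K * (1 + y ^ 2)⁻¹ := by
          exact mul_le_mul_of_nonneg_right (le_max_left _ _) (by positivity)
  · have hyη : η ≤ |y| := (le_max_left η 1).trans hy.le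
    have hy1 : 1 ≤ |y| := (le_max_right η 1).trans hy.le
    have hb := hD y hyη
    calc ‖F ((c : ℂ) + y * I)‖ ≤ D / y ^ 2 := hb
      _ ≤ 2 * D * (1 + y ^ 2)⁻¹ := by
          have hy2 : 1 ≤ y ^ 2 := by nlinarith [sq_abs y, abs_nonneg y]
          rw [← div_eq_mul_inv, div_le_div_iff₀ (by positivity) h1y]
          nlinarith [hD0']
      _ ≤ K * (1 + y ^ 2)⁻¹ := mul_le_mul_of_nonneg_right (le_max_right _ _) (by positivity)

/-! ### Formula (4.6): `(1/2πi)∫_{(α)} (−ζ'/ζ)(w) F₀(s − w) dw = K(s) + f(0) ζ'/ζ(s)` -/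

open LSeries in
open scoped LSeries.notation ArithmeticFunction.vonMangoldt in
/-- **Ford 2002, Lemma 4.5, display (4.6).** Let `f` be an admissible smoothing
(`IsFordSmoothing f η D`, `η > 0`), `F₀ = ℒ(f − f(0)) = F − f(0)/z`, `K(s) = Σ Λ(n) n^{−s} f(log n)`.
For `Re s > 1` and `1 < α < Re s`,
`(1/2π) ∫_{−∞}^{∞} (−ζ'/ζ)(α + iy) F₀(s − α − iy) dy = K(s) + f(0) ζ'(s)/ζ(s)`
(here `−ζ'/ζ = L(Λ, ·)`, Mathlib's `LSeries ↗Λ`). Ford: "we may integrate term by term … `I = Σ Λ(n) J_n`,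
`J_n = n^{−s}(f(log n) − f(0))`". The termwise step is Laplace inversion (`laplace_inversion`, from
Mathlib's Mellin inversion) in place of Ford's Perron integral for `f'`.
[cite: Ford2002Millennium, Lemma 4.5, (4.6)] -/
theorem integral_LSeries_vonMangoldt_mul_laplace {f : ℝ → ℝ} {η D : ℝ} (hf : IsFordSmoothing f η D)
    (hη : 0 < η) {s : ℂ} {α : ℝ} (hα : 1 < α) (hαs : α < s.re) :
    ((1 / (2 * π) : ℝ) : ℂ) * ∫ y : ℝ, LSeries ↗Λ ((α : ℂ) + y * I) *
        fordLaplace (fun u ↦ f u - f 0) (s - ((α : ℂ) + y * I)) =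
      fordK f s + (f 0 : ℂ) * (deriv riemannZeta s / riemannZeta s) := by
  -- notation and basic facts
  set g : ℝ → ℝ := fun u ↦ f u - f 0 with hg
  set F₀ : ℂ → ℂ := fordLaplace g with hF₀
  set c : ℝ := s.re - α with hc
  set t : ℝ := s.im with ht
  have hc0 : 0 < c := by rw [hc]; linarith
  have hs1 : 1 < s.re := hα.trans hαs
  have hfc : Continuous f := hf.contDiff.continuous
  obtain ⟨x₀, hx₀⟩ := hf.eventually_zero
  obtain ⟨M, hM⟩ : ∃ M, ∀ u, 0 ≤ u → |f u| ≤ M := by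
    obtain ⟨B, hB⟩ := (isCompact_Icc (a := (0 : ℝ)) (b := |x₀| + 1)).exists_bound_of_continuousOn
      hfc.continuousOn
    refine ⟨max B 0, fun u hu ↦ ?_⟩
    by_cases hux : u ≤ |x₀| + 1
    · exact ((Real.norm_eq_abs _).symm.le.trans (hB u ⟨hu, hux⟩)).trans (le_max_left _ _)
    · have : f u = 0 := hx₀ u (by linarith [le_abs_self x₀])
      rw [this, abs_zero]; exact le_max_right _ _
  have hgc : Continuous g := hfc.sub continuous_const
  have hgM : ∀ u, 0 < u → |g u| ≤ 2 * M := by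
    intro u hu
    calc |g u| = |f u - f 0| := rfl
      _ ≤ |f u| + |f 0| := abs_sub _ _
      _ ≤ M + M := add_le_add (hM u hu.le) (hM 0 le_rfl)
      _ = 2 * M := by ring
  have hV : Complex.VerticalIntegrable F₀ c := verticalIntegrable_fordLaplace_sub hf hη hc0
  -- `s - (α + iy) = c + (t - y) i`
  have hsw : ∀ y : ℝ, s - ((α : ℂ) + y * I) = (c : ℂ) + ((t - y : ℝ) : ℂ) * I := fun y ↦ by
    apply Complex.ext <;> simp [hc, ht]
  -- the terms
  set a : ℕ → ℝ → ℂ := fun n y ↦ term ↗Λ ((α : ℂ) + y * I) n * F₀ (s - ((α : ℂ) + y * I)) with ha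
  -- `‖term Λ (α+iy) n‖ = ‖term Λ α n‖`
  have hterm_norm : ∀ (n : ℕ) (y : ℝ), ‖term ↗Λ ((α : ℂ) + y * I) n‖ = ‖term ↗Λ (α : ℂ) n‖ := by
    intro n y
    rw [norm_term_eq, norm_term_eq]
    simp
  have hsumα : Summable fun n ↦ ‖term ↗Λ (α : ℂ) n‖ :=
    (ArithmeticFunction.LSeriesSummable_vonMangoldt (s := (α : ℂ)) (by simpa using hα)).norm
  -- integrability of each term and the summability of the integrals of norms
  have hFint : Integrable fun y : ℝ ↦ F₀ (s - ((α : ℂ) + y * I)) := by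
    have h := (hV.comp_sub_left t)
    refine h.congr (ae_of_all _ fun y ↦ ?_)
    simp only
    rw [hsw y]
  have ha_int : ∀ n, Integrable (a n) := fun n ↦ by
    refine (hFint.const_mul (‖term ↗Λ (α : ℂ) n‖ : ℂ)).norm.mono' ?_ (ae_of_all _ fun y ↦ ?_)
    · refine (Continuous.aestronglyMeasurable ?_).mul hFint.aestronglyMeasurable
      -- `y ↦ term Λ (α + iy) n` is continuous
      rcases Nat.eq_zero_or_pos n with hn | hn
      · subst hn; simp [term_zero]; exact continuous_const
      · have hne : n ≠ 0 := Nat.pos_iff_ne_zero.1 hn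
        simp only [term_of_ne_zero hne]
        refine continuous_const.div (Continuous.const_cpow (by fun_prop) (Or.inl ?_)) fun y ↦ ?_
        · exact_mod_cast hne
        · exact cpow_ne_zero_iff_of_exponent_ne_zero (by
            intro h; have := congrArg Complex.re h; simp at this; linarith) |>.2 (by exact_mod_cast hne)
    · simp only [ha, norm_mul, hterm_norm, Complex.norm_real, Real.norm_eq_abs, abs_norm]
      rfl
  -- `Σ_n ∫ ‖a n‖ < ∞`
  set V : ℝ := ∫ y : ℝ, ‖F₀ (s - ((α : ℂ) + y * I))‖ with hV'
  have ha_norm : ∀ n, ∫ y, ‖a n y‖ = ‖term ↗Λ (α : ℂ) n‖ * V := by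
    intro n
    have : (fun y : ℝ ↦ ‖a n y‖) = fun y : ℝ ↦ ‖term ↗Λ (α : ℂ) n‖ * ‖F₀ (s - ((α : ℂ) + y * I))‖ := by
      funext y; simp only [ha, norm_mul, hterm_norm]
    rw [this, MeasureTheory.integral_const_mul]
  have hsum_int : Summable fun n ↦ ∫ y, ‖a n y‖ := by
    simp_rw [ha_norm]; exact hsumα.mul_right V
  -- interchange of sum and integral
  have hswap := integral_tsum_of_summable_integral_norm ha_int hsum_int
  have hpt : ∀ y : ℝ, ∑' n, a n y = LSeries ↗Λ ((α : ℂ) + y * I) * F₀ (s - ((α : ℂ) + y * I)) := by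
    intro y; simp only [ha]; rw [tsum_mul_right]; rfl
  have hI : ∫ y : ℝ, LSeries ↗Λ ((α : ℂ) + y * I) * F₀ (s - ((α : ℂ) + y * I)) = ∑' n, ∫ y, a n y := by
    rw [hswap]; exact integral_congr_ae (ae_of_all _ fun y ↦ (hpt y).symm)
  -- each `∫ a n = 2π Λ(n) n^{-s} g(log n)` (Laplace inversion for `n ≥ 2`; `Λ(0) = Λ(1) = 0`)
  have hΛ0 : (fun n : ℕ ↦ ((Λ n : ℝ) : ℂ)) 0 = 0 := by simp
  have hJ : ∀ n : ℕ, ∫ y, a n y = (2 * π : ℂ) * (((Λ n : ℝ) : ℂ) * (n : ℂ) ^ (-s) * (g (Real.log n) : ℂ)) := by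
    intro n
    rcases Nat.lt_or_ge n 2 with hn | hn
    · interval_cases n
      · simp [ha]
      · simp [ha, ArithmeticFunction.vonMangoldt_apply_one]
    · have hn0 : (n : ℂ) ≠ 0 := by exact_mod_cast (show n ≠ 0 by omega)
      have h1 : ∀ y : ℝ, a n y = ((Λ n : ℝ) : ℂ) * (n : ℂ) ^ (-s) *
          ((fun y' : ℝ ↦ (n : ℂ) ^ ((c : ℂ) + y' * I) * F₀ ((c : ℂ) + y' * I)) (t - y)) := by
        intro y
        simp only [ha, term_of_ne_zero (show n ≠ 0 by omega), hsw y]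
        have hexp : -((α : ℂ) + y * I) = -s + ((c : ℂ) + ((t - y : ℝ) : ℂ) * I) := by
          apply Complex.ext <;> simp [hc, ht] <;> ring
        rw [div_eq_mul_inv, ← Complex.cpow_neg, hexp, Complex.cpow_add _ _ hn0]
        ring
      simp_rw [h1]
      rw [MeasureTheory.integral_const_mul,
        integral_sub_left_eq_self (fun y' : ℝ ↦ (n : ℂ) ^ ((c : ℂ) + y' * I) * F₀ ((c : ℂ) + y' * I)) volume t]
      have hinv := laplace_inversion hgc hgM hc0 hV (x := n) (by exact_mod_cast hn)
      rw [← hF₀, Complex.ofReal_natCast] at hinv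
      have hint_eq : ∫ y' : ℝ, (n : ℂ) ^ ((c : ℂ) + y' * I) * F₀ ((c : ℂ) + y' * I) =
          (2 * π : ℂ) * (g (Real.log n) : ℂ) := by
        rw [← hinv, ← mul_assoc]
        have h2 : (2 * π : ℂ) * (((1 / (2 * π) : ℝ)) : ℂ) = 1 := by
          push_cast; field_simp
        rw [h2, one_mul]
      rw [hint_eq]; ring
  rw [hI]
  simp_rw [hJ]
  rw [tsum_mul_left, ← mul_assoc]
  have h2 : (((1 / (2 * π) : ℝ)) : ℂ) * (2 * π : ℂ) = 1 := by push_cast; field_simp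
  rw [h2, one_mul]
  -- the two Dirichlet series
  have hsumL : Summable fun n : ℕ ↦ ((Λ n : ℝ) : ℂ) * (n : ℂ) ^ (-s) := by
    have h := (ArithmeticFunction.LSeriesSummable_vonMangoldt hs1)
    rw [LSeriesSummable] at h
    refine h.congr fun n ↦ ?_
    rw [term_def₀ hΛ0]
  have hLs : LSeries ↗Λ s = ∑' n : ℕ, ((Λ n : ℝ) : ℂ) * (n : ℂ) ^ (-s) := by
    rw [LSeries]; exact tsum_congr fun n ↦ by rw [term_def₀ hΛ0]
  have hsumK : Summable fun n : ℕ ↦ ((Λ n : ℝ) : ℂ) * (n : ℂ) ^ (-s) * (f (Real.log n) : ℂ) := by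
    refine Summable.of_norm_bounded (g := fun n ↦ ‖((Λ n : ℝ) : ℂ) * (n : ℂ) ^ (-s)‖ * M)
      (hsumL.norm.mul_right M) fun n ↦ ?_
    rw [norm_mul, Complex.norm_real, Real.norm_eq_abs]
    exact mul_le_mul_of_nonneg_left (hM _ (Real.log_natCast_nonneg n)) (norm_nonneg _)
  have hK : fordK f s = ∑' n : ℕ, ((Λ n : ℝ) : ℂ) * (n : ℂ) ^ (-s) * (f (Real.log n) : ℂ) := by
    rw [fordK]; exact tsum_congr fun n ↦ by ring
  have hg' : ∀ n : ℕ, ((Λ n : ℝ) : ℂ) * (n : ℂ) ^ (-s) * (g (Real.log n) : ℂ) =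
      ((Λ n : ℝ) : ℂ) * (n : ℂ) ^ (-s) * (f (Real.log n) : ℂ) - (f 0 : ℂ) * (((Λ n : ℝ) : ℂ) * (n : ℂ) ^ (-s)) := by
    intro n; simp only [hg]; push_cast; ring
  simp_rw [hg']
  rw [hsumK.tsum_sub (hsumL.mul_left _), tsum_mul_left, ← hK, ← hLs,
    ArithmeticFunction.LSeries_vonMangoldt_eq_deriv_riemannZeta_div hs1]
  ring

end FordL45

end Literature.NumberTheory.LFunctions
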